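import Mathlib

/-!
# CauchyEstimateLipschitz — the Cauchy estimate for the derivative of a holomorphic function of
two variables, and the resulting Lipschitz bound on a compact set

Blind cell `pub-hodge-repro2`, seat p2 (Tier 5 kernel support: towards the finite-dimensionality
of the holomorphic weight-`k` forms on the compact Picard modular surface — equicontinuity of the
Petersson unit ball).

* `norm_fderiv_le_of_forall_norm_le`: for `f : (Fin 2 → ℂ) → ℂ` holomorphic on the open polydisc
  `ball z ρ` (sup norm) and continuous on the closed one, with `‖f‖ ≤ M` on the closed polydisc,
  `‖fderiv ℂ f z‖ ≤ M / ρ` — Mathlib's one-variable Cauchy estimate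
  `Complex.norm_deriv_le_of_forall_mem_sphere_norm_le` applied along every complex line;
* `norm_sub_le_of_forall_norm_le`: for `f` holomorphic on an open set containing the closed
  `2ρ`-thickening of a set `C` and bounded by `M` there, `f` is `(2M/ρ)`-Lipschitz on `C`
  (the mean value inequality `Convex.norm_image_sub_le_of_norm_fderiv_le` on closed polydiscs).

Mathlib only.
-/

namespace Summit.Ventures.HodgeRepro2.CauchyEstimate

open Metric Set

variable {f : (Fin 2 → ℂ) → ℂ}

/-- The derivative of `f` at `z` in a direction `u` of norm at most `1` is bounded by `M / ρ`
when `‖f‖ ≤ M` on the closed polydisc of radius `ρ`. -/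
theorem norm_fderiv_apply_le {z : Fin 2 → ℂ} {ρ M : ℝ} (hρ : 0 < ρ)
    (hf : DifferentiableOn ℂ f (ball z ρ)) (hfc : ContinuousOn f (closedBall z ρ))
    (hb : ∀ w ∈ closedBall z ρ, ‖f w‖ ≤ M) {u : Fin 2 → ℂ} (hu : ‖u‖ ≤ 1) :
    ‖fderiv ℂ f z u‖ ≤ M / ρ := by
  -- the complex line `t ↦ z + t • u`
  have hz : HasFDerivAt f (fderiv ℂ f z) z :=
    (hf.differentiableAt (isOpen_ball.mem_nhds (mem_ball_self hρ))).hasFDerivAt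
  have hz' : HasFDerivAt f (fderiv ℂ f z) (z + (0:ℂ) • u) := by simpa using hz
  have hl : HasDerivAt (fun t : ℂ => z + t • u) u 0 := by
    have := ((hasDerivAt_id (0:ℂ)).smul_const u).const_add z
    simpa using this
  have hg : HasDerivAt (f ∘ fun t : ℂ => z + t • u) (fderiv ℂ f z u) 0 := hz'.comp_hasDerivAt 0 hl
  have hmaps : ∀ t : ℂ, t ∈ closedBall (0:ℂ) ρ → z + t • u ∈ closedBall z ρ := by
    intro t ht
    rw [mem_closedBall, dist_eq_norm, add_sub_cancel_left, norm_smul]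
    rw [mem_closedBall, dist_zero_right] at ht
    calc ‖t‖ * ‖u‖ ≤ ‖t‖ * 1 := by gcongr
      _ = ‖t‖ := mul_one _
      _ ≤ ρ := ht
  have hmaps' : ∀ t : ℂ, t ∈ ball (0:ℂ) ρ → z + t • u ∈ ball z ρ := by
    intro t ht
    rw [mem_ball, dist_eq_norm, add_sub_cancel_left, norm_smul]
    rw [mem_ball, dist_zero_right] at ht
    calc ‖t‖ * ‖u‖ ≤ ‖t‖ * 1 := by gcongr
      _ = ‖t‖ := mul_one _
      _ < ρ := ht
  have hline : Differentiable ℂ (fun t : ℂ => z + t • u) := by fun_prop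
  have hd : DiffContOnCl ℂ (f ∘ fun t : ℂ => z + t • u) (ball (0:ℂ) ρ) := by
    refine ⟨hf.comp hline.differentiableOn hmaps', ?_⟩
    rw [closure_ball _ hρ.ne']
    exact hfc.comp hline.continuous.continuousOn hmaps
  have hC : ∀ t ∈ sphere (0:ℂ) ρ, ‖(f ∘ fun t : ℂ => z + t • u) t‖ ≤ M := by
    intro t ht
    exact hb _ (hmaps t (sphere_subset_closedBall ht))
  have := Complex.norm_deriv_le_of_forall_mem_sphere_norm_le hρ hd hC
  rwa [hg.deriv] at this

/-- **The Cauchy estimate** for the Fréchet derivative: `‖fderiv ℂ f z‖ ≤ M / ρ` when `‖f‖ ≤ M`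
on the closed polydisc `closedBall z ρ` and `f` is holomorphic on the open polydisc. -/
theorem norm_fderiv_le_of_forall_norm_le {z : Fin 2 → ℂ} {ρ M : ℝ} (hρ : 0 < ρ) (hM : 0 ≤ M)
    (hf : DifferentiableOn ℂ f (ball z ρ)) (hfc : ContinuousOn f (closedBall z ρ))
    (hb : ∀ w ∈ closedBall z ρ, ‖f w‖ ≤ M) : ‖fderiv ℂ f z‖ ≤ M / ρ := by
  refine ContinuousLinearMap.opNorm_le_bound _ (div_nonneg hM hρ.le) fun v => ?_
  by_cases hv : v = 0
  · simp [hv]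
  have hvn : 0 < ‖v‖ := norm_pos_iff.mpr hv
  set u : Fin 2 → ℂ := ((‖v‖⁻¹ : ℝ) : ℂ) • v with hudef
  have hu : ‖u‖ ≤ 1 := by
    rw [hudef, norm_smul, Complex.norm_real, Real.norm_eq_abs, abs_of_pos (inv_pos.mpr hvn),
      inv_mul_cancel₀ hvn.ne']
  have hvu : v = ((‖v‖ : ℝ) : ℂ) • u := by
    rw [hudef, smul_smul, ← Complex.ofReal_mul, mul_inv_cancel₀ hvn.ne', Complex.ofReal_one,
      one_smul]
  calc ‖fderiv ℂ f z v‖ = ‖fderiv ℂ f z (((‖v‖ : ℝ) : ℂ) • u)‖ := by rw [← hvu]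
    _ = ‖v‖ * ‖fderiv ℂ f z u‖ := by
        rw [map_smul, norm_smul, Complex.norm_real, Real.norm_eq_abs, abs_of_pos hvn]
    _ ≤ ‖v‖ * (M / ρ) := by
        gcongr
        exact norm_fderiv_apply_le hρ hf hfc hb hu
    _ = M / ρ * ‖v‖ := mul_comm _ _

/-- **Lipschitz bound on a set from a sup bound on its `2ρ`-thickening.** If `f` is holomorphic on
an open `U` containing the closed `2ρ`-thickening of `C` and `‖f‖ ≤ M` on that thickening, then
`‖f z - f w‖ ≤ (2M/ρ) ‖z - w‖` for all `z, w ∈ C`. -/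
theorem norm_sub_le_of_forall_norm_le {C U : Set (Fin 2 → ℂ)} {ρ M : ℝ} (hρ : 0 < ρ) (hM : 0 ≤ M)
    (hU : IsOpen U) (hsub : cthickening (2 * ρ) C ⊆ U) (hf : DifferentiableOn ℂ f U)
    (hb : ∀ w ∈ cthickening (2 * ρ) C, ‖f w‖ ≤ M) {z w : Fin 2 → ℂ} (hz : z ∈ C) (hw : w ∈ C) :
    ‖f z - f w‖ ≤ (2 * M / ρ) * ‖z - w‖ := by
  have hfc : ContinuousOn f U := hf.continuousOn
  by_cases hzw : ‖z - w‖ ≤ ρ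
  · -- the mean value inequality on the closed polydisc `closedBall z ρ`
    have hball : closedBall z ρ ⊆ cthickening ρ C := closedBall_subset_cthickening hz ρ
    have hbound : ∀ y ∈ closedBall z ρ, ‖fderiv ℂ f y‖ ≤ M / ρ := by
      intro y hy
      have hy2 : closedBall y ρ ⊆ cthickening (2 * ρ) C := by
        refine (closedBall_subset_cthickening (hball hy) ρ).trans ?_
        refine (cthickening_cthickening_subset hρ.le hρ.le C).trans ?_
        rw [show ρ + ρ = 2 * ρ by ring]
      refine norm_fderiv_le_of_forall_norm_le hρ hM (hf.mono (ball_subset_closedBall.trans (hy2.trans hsub)))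
        (hfc.mono (hy2.trans hsub)) fun v hv => hb v (hy2 hv)
    have hdiff : ∀ y ∈ closedBall z ρ, DifferentiableAt ℂ f y := by
      intro y hy
      have hyU : y ∈ U := hsub ((closedBall_subset_cthickening (hball hy) ρ).trans
        ((cthickening_cthickening_subset hρ.le hρ.le C).trans (by rw [show ρ + ρ = 2 * ρ by ring]))
        (mem_closedBall_self hρ.le))
      exact hf.differentiableAt (hU.mem_nhds hyU)
    have hwz : w ∈ closedBall z ρ := by
      rw [mem_closedBall, dist_eq_norm, norm_sub_rev]
      exact hzw
    have := (convex_closedBall z ρ).norm_image_sub_le_of_norm_fderiv_le hdiff hbound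
      hwz (mem_closedBall_self hρ.le)
    calc ‖f z - f w‖ ≤ M / ρ * ‖z - w‖ := this
      _ ≤ (2 * M / ρ) * ‖z - w‖ := by
          gcongr
          linarith
  · -- far apart: use the sup bound twice
    have hzw' : ρ ≤ ‖z - w‖ := (not_le.mp hzw).le
    have hzC : z ∈ cthickening (2 * ρ) C := self_subset_cthickening C hz
    have hwC : w ∈ cthickening (2 * ρ) C := self_subset_cthickening C hw
    calc ‖f z - f w‖ ≤ ‖f z‖ + ‖f w‖ := norm_sub_le _ _
      _ ≤ M + M := add_le_add (hb z hzC) (hb w hwC)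
      _ = (2 * M / ρ) * ρ := by field_simp; ring
      _ ≤ (2 * M / ρ) * ‖z - w‖ := by gcongr

end Summit.Ventures.HodgeRepro2.CauchyEstimate
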